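import Summits.BirchSwinnertonDyer.BirchSwinnertonDyer.Theorems.SchneiderFreeAdditiveX3GordCellThreeOfPrintTorsion
import HarnessLib

/-!
# Route `SchneiderFreeAdditiveX3` (K1 door): Keller–Yin's standing hypothesis «`H⁰(K, ρ̄) = 0`» is AUTOMATIC for the GOOD LATTICE at a prime
# split in the quadratic field — `V(K)[p] = 0` when every rational `p`-line of `V` is ramified at `p` and `(p)` splits in `K` (quadratic descent)

Cell `bsd-schneider-ideate`, seat `bsd-schneider-door-c5` (prover, generation 28; assembly layer; `--supports` 19177).
PARTITION: board row B6 ∩ X3 ∩ sst-twist, `r = 1`, (G-ord, `e = 2`) half at `p = 3`, ANOMALOUS pairs (binder discharge for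
`…AnomalousTwistMuZeroOfPartner` / `…UpperGordCellThreeAnomalousOfPartner`); types-the-object-of nothing; closes none of B6's cells (BSD NOT advanced).
bears_on: K1-door (19177 r3).

WHY.  Cell `bsd-eis`'s typed Keller–Yin 2402.12781 character inputs [RH] / [PWL-θ] carry, as binders of the good anomalous curve `V` they are read at,
Keller–Yin's standing normalisation: every rational `p`-line of `V` RAMIFIED at `p` (the good lattice, Prop. 1.3.1) and `V(K)[p] = 0` («we could
always assume `H⁰(K, ρ̄_f) = 0`», §1.4 TeX L1083).  The second follows from the first for every quadratic `K` in which `p` splits — the door's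
Heegner fields: a `K`-rational point of order `p` would produce, by the odd-part quadratic descent `#V(K)[p^∞] = #V(ℚ)[p^∞]·#V^{(d_K)}(ℚ)[p^∞]`, a
rational point of order `p` on `V` or on `V^{(d_K)}`, i.e. a rational `p`-line of `V` on which `Γ_ℚ` acts trivially resp. through the sign of
`√d_K` — in both cases UNRAMIFIED at `p` (`p ∤ 4d_K`).  Generation 26's `KYBranchThreeTorsion.forall_baseChange_nsmul_eq_zero_of_hna` with the
non-anomalous clause replaced by the good-lattice clause.  Theorems only; no definition, no named fact, no `sorry`.
References: [KellerYin2024] Prop. 1.3.1 and §1.4 (arXiv:2402.12781v2); [SilvermanAEC2009] X.5 Cor. 5.4, Exercise 10.16; [Mazur1977] Ch. III §5;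
this seat p682313 (generation 26).
-/

set_option autoImplicit false
-- `Summit.<P>.<Sub>` repeats `BirchSwinnertonDyer` by the tree's layout convention (D-0017)
set_option linter.dupNamespace false

noncomputable section

open scoped Classical NumberField Pointwise

open Field NumberField IsDedekindDomain WeierstrassCurve PowerSeries Rat.HeightOneSpectrum
  Literature.NumberTheory.EllipticCurves Literature.NumberTheory.EllipticCurves.GreenbergSelmer
  Literature.NumberTheory.GaloisRepresentations Literature.NumberTheory.GaloisCohomology
  Literature.NumberTheory.EllipticCurves.ModularForms Literature.NumberTheory.EllipticCurves.Rank1Residual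
  Literature.NumberTheory.EllipticCurves.KellerYin2024 Literature.NumberTheory.EllipticCurves.CaiShuTian2014
  Literature.NumberTheory.QuadraticFields
  Literature.NumberTheory.IwasawaTheory Literature.NumberTheory.IwasawaTheory.Greenberg2016
  Literature.NumberTheory.IwasawaTheory.Greenberg2006
  Summit.BirchSwinnertonDyer.Rank1Residual Summit.BirchSwinnertonDyer.Rank1Residual.X11b
  Summit.BirchSwinnertonDyer.Rank1Residual.X11b.AcSelmer Summit.BirchSwinnertonDyer.Rank1Residual.X11b.Halves
  Summit.BirchSwinnertonDyer.Rank1Residual.X11b.CongruenceLimit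
  Summit.BirchSwinnertonDyer.Rank1Residual.Additive
  Summit.BirchSwinnertonDyer.BirchSwinnertonDyer.Theorems.SchneiderFree
  Summit.BirchSwinnertonDyer.BirchSwinnertonDyer.Theorems.SchneiderFree.KYRead
  Summit.BirchSwinnertonDyer.BirchSwinnertonDyer.Theorems.SchneiderFree.GoodMember
  Summit.BirchSwinnertonDyer.BirchSwinnertonDyer.Theses.SchneiderFreeAdditiveX3
  Summit.BirchSwinnertonDyer.BirchSwinnertonDyer.Theorems.SchneiderFreeAdditiveX3.LZZMatch
  Summit.BirchSwinnertonDyer.BirchSwinnertonDyer.Theorems.SchneiderFreeAdditiveX3.ControlDischarged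
  Summit.BirchSwinnertonDyer.BirchSwinnertonDyer.Theorems.SchneiderFreeAdditiveX3.KYBranchOnly
  Summit.BirchSwinnertonDyer.BirchSwinnertonDyer.Theorems.SchneiderFreeAdditiveX3.KYBranchThree
  Summit.BirchSwinnertonDyer.BirchSwinnertonDyer.Theorems.SchneiderFreeAdditiveX3.KYBranchThreeDoor
  Summit.BirchSwinnertonDyer.BirchSwinnertonDyer.Theorems.SchneiderFreeAdditiveX3.KYBranchThreeLattice
  Summit.BirchSwinnertonDyer.BirchSwinnertonDyer.Theorems.SchneiderFreeAdditiveX3.KYBranchThreeTorsion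
  Summit.BirchSwinnertonDyer.BirchSwinnertonDyer.Theorems.SchneiderFreeAdditiveX3.KYNonAnomalousTwist

namespace Summit.BirchSwinnertonDyer.BirchSwinnertonDyer.Theorems.SchneiderFreeAdditiveX3.GoodLatticeNoKTorsion

/-! ### `V(K)[p] = 0` for the good lattice when `p` splits in the quadratic field `K` -/

/-- **No rational point of order `p` when every rational `p`-line is ramified at `p`**: a rational point of order `p` spans a rational line fixed
pointwise by `Γ_ℚ`, in particular unramified at `p`. [cite: KellerYin2024, Prop. 1.3.1 (the good lattice; arXiv:2402.12781v2)] [cite: Mazur1977, Ch. III §5] -/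
theorem addOrderOf_ne_of_forall_not_lineUnramifiedAt {V : WeierstrassCurve ℚ} [V.IsElliptic] {p : ℕ} [hp : Fact p.Prime]
    (hlat : ∀ Φ : AddSubgroup (geomTorsion V (p : ℤ)), IsRationalLine V p Φ → ¬ LineUnramifiedAt V p Φ)
    (R : V.toAffine.Point) : addOrderOf R ≠ p := by
  haveI : NeZero (p : ℚ) := ⟨Nat.cast_ne_zero.mpr hp.out.ne_zero⟩
  intro hR
  obtain ⟨P₁, -, hP₁0, hP₁fix⟩ := exists_geomTorsion_of_addOrderOf_eq V hR
  have hord : addOrderOf P₁ = p := addOrderOf_eq_of_ne_zero V p hP₁0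
  have hline : IsRationalLine V p (AddSubgroup.zmultiples P₁) := by
    refine ⟨by rw [Nat.card_zmultiples, hord], fun σ Q hQ ↦ ?_⟩
    obtain ⟨m, rfl⟩ := AddSubgroup.mem_zmultiples_iff.mp hQ
    rw [smul_comm σ m P₁, hP₁fix σ]
    exact AddSubgroup.zsmul_mem _ (AddSubgroup.mem_zmultiples P₁) m
  refine hlat _ hline fun v _ 𝔓 _ σ _ Q hQ ↦ ?_
  obtain ⟨m, rfl⟩ := AddSubgroup.mem_zmultiples_iff.mp hQ
  rw [smul_comm σ m P₁, hP₁fix σ]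

/-- **No rational point of order `p` on the twist `V^{(d_K)}` either** (`p` odd, SPLIT in the quadratic field `K`, every rational `p`-line of `V`
ramified at `p`): along the sign-equivariant `V^{(d_K)}[p] ≃ V[p]` a rational point of order `p` of the twist becomes `Q₁ ∈ V[p]` with `σQ₁ = ±Q₁`
(the sign of `σ` on `√d_K`), so `ℤQ₁` is a rational line on which every inertia group above `p` acts trivially (`p ∤ 4d_K`: `√d_K` is fixed by
inertia, tree `smul_geomSqrt_eq_of_mem_inertia`) — an UNRAMIFIED rational line, excluded.  (Generation 26's `addOrderOf_ne_twist_of_hna` with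
`hna` replaced by the good-lattice clause.) [cite: SilvermanAEC2009, X.5 Cor. 5.4] [cite: KellerYin2024, Prop. 1.3.1 (arXiv:2402.12781v2)] -/
theorem addOrderOf_ne_twist_of_forall_not_lineUnramifiedAt {V : WeierstrassCurve ℚ} [V.IsElliptic] {p : ℕ} [hp : Fact p.Prime] (hp2 : p ≠ 2)
    (hlat : ∀ Φ : AddSubgroup (geomTorsion V (p : ℤ)), IsRationalLine V p Φ → ¬ LineUnramifiedAt V p Φ)
    (K : Type) [Field K] [NumberField K] (h2K : Module.finrank ℚ K = 2)
    (hsplit : ((Ideal.span {(p : ℤ)}).primesOver (𝓞 K)).ncard = 2)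
    (R : (V.quadraticTwist ((NumberField.discr K : ℤ) : ℚ)).toAffine.Point) : addOrderOf R ≠ p := by
  haveI : NeZero (p : ℚ) := ⟨Nat.cast_ne_zero.mpr hp.out.ne_zero⟩
  intro hR
  have hpd : ¬ (p : ℤ) ∣ NumberField.discr K := not_dvd_discr_of_ncard_primesOver_eq_two hp.out h2K hsplit
  have hpd4 : ¬ (p : ℤ) ∣ 4 * NumberField.discr K := by
    intro h
    rcases (Nat.prime_iff_prime_int.mp hp.out).dvd_or_dvd h with h4 | hd
    · have h4' : p ∣ 2 ^ 2 := by exact_mod_cast h4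
      exact hp2 ((Nat.prime_dvd_prime_iff_eq hp.out Nat.prime_two).mp (hp.out.dvd_of_dvd_pow h4'))
    · exact hpd hd
  have hd0 : (NumberField.discr K : ℤ) ≠ 0 := NumberField.discr_ne_zero K
  obtain ⟨P₁, -, hP₁0, hP₁fix⟩ := exists_geomTorsion_of_addOrderOf_eq (V.quadraticTwist ((NumberField.discr K : ℤ) : ℚ)) hR
  have hd0' : ((NumberField.discr K : ℤ) : ℚ) ≠ 0 := by exact_mod_cast hd0
  obtain ⟨e, hepos, heneg⟩ := exists_signEquiv_of_twist (W := V) (Wd := V.quadraticTwist ((NumberField.discr K : ℤ) : ℚ))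
    (p := p) hd0' 1 (one_smul _ _)
  set Q₁ : geomTorsion V (p : ℤ) := e P₁ with hQ₁
  have hQ₁0 : Q₁ ≠ 0 := fun h ↦ hP₁0 (e.injective (by rw [← hQ₁, h, map_zero]))
  have hsign : ∀ σ : absoluteGaloisGroup ℚ,
      σ • Q₁ = if σ • geomSqrt ((NumberField.discr K : ℤ) : ℚ) = geomSqrt ((NumberField.discr K : ℤ) : ℚ) then Q₁ else -Q₁ := by
    intro σ
    by_cases hs : σ • geomSqrt ((NumberField.discr K : ℤ) : ℚ) = geomSqrt ((NumberField.discr K : ℤ) : ℚ)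
    · rw [if_pos hs, hQ₁, ← hepos σ hs P₁, hP₁fix]
    · rw [if_neg hs, hQ₁]
      have h := heneg σ hs P₁
      rw [hP₁fix] at h
      have h' := congrArg Neg.neg h
      rw [neg_neg] at h'
      exact h'.symm
  have hord : addOrderOf Q₁ = p := addOrderOf_eq_of_ne_zero V p hQ₁0
  have hline : IsRationalLine V p (AddSubgroup.zmultiples Q₁) := by
    refine ⟨by rw [Nat.card_zmultiples, hord], fun σ Q hQ ↦ ?_⟩
    obtain ⟨m, rfl⟩ := AddSubgroup.mem_zmultiples_iff.mp hQ
    rw [smul_comm σ m Q₁, hsign σ]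
    split_ifs
    · exact AddSubgroup.zsmul_mem _ (AddSubgroup.mem_zmultiples Q₁) m
    · rw [smul_neg]
      exact AddSubgroup.neg_mem _ (AddSubgroup.zsmul_mem _ (AddSubgroup.mem_zmultiples Q₁) m)
  -- every inertia group above `p` fixes `√d_K`, hence `ℤQ₁` pointwise: an unramified rational line
  refine hlat _ hline fun v hpv 𝔓 h𝔓 σ hσ Q hQ ↦ ?_
  obtain ⟨m, rfl⟩ := AddSubgroup.mem_zmultiples_iff.mp hQ
  rw [smul_comm σ m Q₁, hsign σ, if_pos (smul_geomSqrt_eq_of_mem_inertia hpd4 hpv h𝔓 hσ)]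

/-- **`V(K)[p] = 0` for the good lattice at a prime split in the quadratic field `K`.**  `p` odd, every rational `p`-line of `V` ramified at `p`
(Keller–Yin's normalisation, Prop. 1.3.1), `K` quadratic with `(p)` split: then `V(K)` has no point of order `p` — Keller–Yin's standing hypothesis
«`H⁰(K, ρ̄_f) = 0`» is AUTOMATIC at every Heegner field of the door.  The odd-part quadratic descent `#V(K)[p^∞] = #V(ℚ)[p^∞] · #V^{(d_K)}(ℚ)[p^∞]`
(tree `card_primaryComponent_point_baseChange_quadratic_of_odd'`) and the two statements above (generation 26's `forall_baseChange_nsmul_eq_zero_of_hna`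
pattern). [cite: SilvermanAEC2009, X.5 Cor. 5.4 and Exercise 10.16] [cite: KellerYin2024, §1.4 (standing hypothesis H⁰(K, ρ̄_f) = 0, TeX L1083) and Prop. 1.3.1] -/
theorem forall_baseChange_nsmul_eq_zero_of_forall_not_lineUnramifiedAt {V : WeierstrassCurve ℚ} [V.IsElliptic] {p : ℕ} [hp : Fact p.Prime]
    (hp2 : p ≠ 2) (hlat : ∀ Φ : AddSubgroup (geomTorsion V (p : ℤ)), IsRationalLine V p Φ → ¬ LineUnramifiedAt V p Φ)
    {K : Type} [Field K] [NumberField K] (h2K : Module.finrank ℚ K = 2)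
    (hsplit : ((Ideal.span {(p : ℤ)}).primesOver (𝓞 K)).ncard = 2)
    (Q : (V.baseChange K).toAffine.Point) (hQ : p • Q = 0) : Q = 0 := by
  have hpd : ¬ (p : ℤ) ∣ NumberField.discr K := not_dvd_discr_of_ncard_primesOver_eq_two hp.out h2K hsplit
  obtain ⟨θ, c, hθ, hc⟩ := Quadratic.exists_sq_eq_algebraMap (F := ℚ) (K := K) h2K
  obtain ⟨q, hq, hd⟩ := NumberField.exists_discr_eq_mul_sq h2K hθ hc
  have hθ' : algebraMap ℚ K q * θ ∉ Set.range (algebraMap ℚ K) := by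
    rintro ⟨r, hr⟩
    apply hθ
    refine ⟨r / q, ?_⟩
    rw [map_div₀, hr, mul_div_cancel_left₀ _ ((map_ne_zero (algebraMap ℚ K)).mpr hq)]
  have hc' : (algebraMap ℚ K q * θ) ^ 2 = algebraMap ℚ K (NumberField.discr K : ℚ) := by
    rw [mul_pow, hc, ← map_pow, ← map_mul, hd, mul_comm]
  have hcard := card_primaryComponent_point_baseChange_quadratic_of_odd' V h2K hθ' hc'
    (Wd := V.quadraticTwist (NumberField.discr K : ℚ)) ⟨1, one_smul _ _⟩
    (W' := V.baseChange K) ⟨1, one_smul _ _⟩ p hp2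
  have h1 : Nat.card (AddCommGroup.primaryComponent V.toAffine.Point p) = 1 := by
    rw [primaryComponent_eq_bot_of_forall_addOrderOf_ne (addOrderOf_ne_of_forall_not_lineUnramifiedAt hlat), AddSubgroup.card_bot]
  have h2 : Nat.card
      (AddCommGroup.primaryComponent (V.quadraticTwist (NumberField.discr K : ℚ)).toAffine.Point p) = 1 := by
    rw [primaryComponent_eq_bot_of_forall_addOrderOf_ne
      (addOrderOf_ne_twist_of_forall_not_lineUnramifiedAt hp2 hlat K h2K hsplit), AddSubgroup.card_bot]
  have key1 : ∀ inst : DecidableEq ℚ, Nat.card (@AddCommGroup.primaryComponent V.toAffine.Point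
      (@Affine.Point.instAddCommGroup ℚ _ V.toAffine inst) p) = 1 := by
    intro inst
    obtain rfl : inst = instDecidableEqRat := Subsingleton.elim _ _
    exact h1
  have key2 : ∀ inst : DecidableEq ℚ, Nat.card (@AddCommGroup.primaryComponent
      (V.quadraticTwist (NumberField.discr K : ℚ)).toAffine.Point
      (@Affine.Point.instAddCommGroup ℚ _ (V.quadraticTwist (NumberField.discr K : ℚ)).toAffine inst) p) = 1 := by
    intro inst
    obtain rfl : inst = instDecidableEqRat := Subsingleton.elim _ _
    exact h2
  have hone : Nat.card (AddCommGroup.primaryComponent (V.baseChange K).toAffine.Point p) = 1 := by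
    rw [hcard, key1, key2]
  have hbot : AddCommGroup.primaryComponent (V.baseChange K).toAffine.Point p = ⊥ :=
    AddSubgroup.card_eq_one.mp hone
  have hQmem : Q ∈ AddCommGroup.primaryComponent (V.baseChange K).toAffine.Point p :=
    (AddCommGroup.mem_primaryComponent).mpr ⟨1, by rw [pow_one]; exact hQ⟩
  rw [hbot, AddSubgroup.mem_bot] at hQmem
  exact hQmem

end Summit.BirchSwinnertonDyer.BirchSwinnertonDyer.Theorems.SchneiderFreeAdditiveX3.GoodLatticeNoKTorsion

end
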